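import Mathlib.Analysis.InnerProductSpace.Laplacian
import Mathlib.Analysis.Calculus.Gradient.Basic
import Mathlib.Analysis.Calculus.LineDeriv.Basic
import Mathlib.Analysis.Calculus.ContDiff.Basic
import Mathlib.Analysis.Calculus.Deriv.Basic
import Mathlib.Analysis.Calculus.FDeriv.Add
import Mathlib.LinearAlgebra.Trace
import Mathlib.Analysis.InnerProductSpace.Trace
import Literature.Analysis.FunctionSpaces.FlatTorus
import HarnessLib

-- provenance: harness21/H21/H21/Prelude/Sobolev/TorusCalculus.lean @ cfecf1d (interim HEAD d8f2665); M5 mechanical rewrite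
/-!
# Pointwise calculus on the flat torus `T^d`  (trunk: Sobolev, concept C2 / notion `flat_torus_T3`)

Representative-free differential calculus for functions `f : UnitAddTorus d → F` on the flat
torus, following the outline `H21/Outlines/Sobolev.md` (§0, D2, §C2) and the style of the accepted
`Statements/Turb/Wave0.lean`: every derivative of `f` at `x ∈ T^d` is the corresponding Mathlib
derivative of the re-centred lift `Torus.liftAt f x : EuclideanSpace ℝ d → F`, `v ↦ f (x + proj v)`,
taken at `v = 0`. Mathlib has no calculus on `AddCircle`/`UnitAddTorus` (no `ChartedSpace`), so
these wrappers are genuinely new; the underlying operators are Mathlib's `fderiv`, `deriv`,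
`lineDeriv`, `gradient`, `InnerProductSpace.laplacian` (notation `Δ`) and `LinearMap.trace`.

## Main definitions

* `Torus.fderiv f x`, `Torus.lineDeriv f x v`, `Torus.partialDeriv i f x`, `Torus.gradient θ x`,
  `Torus.divergence u x`, `Torus.laplacian f x`, `Torus.convect u v x` (`(u·∇)v`);
* `Torus.IsDivFree u`, `Torus.HasZeroMean f`;
* space–time: `Torus.stLift u`, `Torus.IsSmoothSpaceTimeOn S u`, `Torus.timeDerivWithin S u t x`
  (one-sided, for solutions on a time set `S`, as in the accepted `NS.IsNavierStokesSolution`),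
  `Torus.timeDeriv u t x` (two-sided, for test functions living on all of `ℝ`).

## Re-basing contract (outline §0)

`Turb.torusLineDeriv u x v = Torus.lineDeriv u x (WithLp.toLp 2 v)` and
`Turb.torusPartialDeriv u i x = Torus.partialDeriv i u x` hold by `rfl`; the bridge to
`NS.divergence`/`NS.IsDivFree` on the lift is `divergence_eq_trace_fderiv` /
`isDivFree_iff_trace_fderiv_lift` (with `fderiv_lift`).

## Shadowing

Inside `namespace Literature.Torus` the names `fderiv`, `gradient`, `lineDeriv`, `laplacian` shadow
Mathlib's; bodies use `_root_.fderiv ℝ`, `_root_.gradient`, `_root_.lineDeriv` and `Δ`.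

## References

* L. Grafakos, *Classical Fourier Analysis* (3rd ed., 2014), §3.1 (calculus on `T^n` via
  `1`-periodic functions on `ℝ^n`).
* L. C. Evans, *Partial Differential Equations* (2nd ed., 2010), App. C.2, Thms. 2–3
  (Gauss–Green, integration by parts, Green's formulas) — on the torus there is no boundary term.
* C. Fefferman, *Existence and smoothness of the Navier–Stokes equation* (Clay, 2000/2006),
  eqs. (1)–(2), (8).
-/

open MeasureTheory Set Topology
open scoped ContDiff Laplacian InnerProductSpace

namespace Literature.Analysis.FunctionSpaces

noncomputable section

namespace Torus

variable {d : Type*}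
variable {F : Type*} [NormedAddCommGroup F] [NormedSpace ℝ F]

/-! ## Space–time lifts and time derivatives (no finiteness needed) -/

section Time

omit [NormedAddCommGroup F] [NormedSpace ℝ F] in
/-- The space–time lift of `u : ℝ → T^d → F` to `ℝ × ℝ^d`, `(t, y) ↦ u t (proj y)`; smoothness
in `(t, x)` is expressed through it (cf. the accepted `Literature.Analysis.FluidPDE.IsSmoothOnHalfSpace`, which is
`ContDiffOn` of the uncurried field on `Ici 0 ×ˢ univ`) (Fefferman, (A)/(B)). [folklore] -/
def stLift (u : ℝ → UnitAddTorus d → F) : ℝ × EuclideanSpace ℝ d → F :=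
  fun p => u p.1 (proj p.2)

omit [NormedAddCommGroup F] [NormedSpace ℝ F] in
/-- `stLift u (t, y) = u t (proj y)`. [folklore] -/
@[simp]
theorem stLift_apply (u : ℝ → UnitAddTorus d → F) (t : ℝ) (y : EuclideanSpace ℝ d) :
    stLift u (t, y) = u t (proj y) :=
  rfl

/-- The time derivative `∂ₜ u (t, x)` of `u : ℝ → T^d → F` *within* the time set `S`
(`derivWithin`, hence one-sided at endpoints of `S`). This is the convention of all solution
notions, exactly as the accepted `Literature.Analysis.FluidPDE.IsNavierStokesSolution` (`derivWithin _ (Ici 0) t`)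
(Fefferman, eq. (1)). [folklore] -/
def timeDerivWithin (S : Set ℝ) (u : ℝ → UnitAddTorus d → F) (t : ℝ) (x : UnitAddTorus d) : F :=
  derivWithin (fun τ => u τ x) S t

/-- The (two-sided) time derivative `∂ₜ u (t, x)` of `u : ℝ → T^d → F`; used only for test
functions, which live on all of `ℝ` (outline `Sobolev.md`, "Time derivatives"). [folklore] -/
def timeDeriv (u : ℝ → UnitAddTorus d → F) (t : ℝ) (x : UnitAddTorus d) : F :=
  deriv (fun τ => u τ x) t

/-- In the interior of the time set the one-sided and two-sided time derivatives agree
(Mathlib `derivWithin_of_mem_nhds`). [folklore] -/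
theorem timeDerivWithin_of_mem_interior {S : Set ℝ} {u : ℝ → UnitAddTorus d → F} {t : ℝ}
    (ht : t ∈ interior S) (x : UnitAddTorus d) : timeDerivWithin S u t x = timeDeriv u t x :=
  derivWithin_of_mem_nhds (mem_interior_iff_mem_nhds.1 ht)

end Time

variable [Fintype d] [DecidableEq d]

/-! ## Space derivatives -/

section Space

omit [DecidableEq d] in
/-- The Fréchet derivative of `f : T^d → F` at `x`, a continuous linear map
`ℝ^d = T_x T^d →L[ℝ] F`: the Fréchet derivative of the re-centred lift `v ↦ f (x + proj v)` at
`v = 0` (Grafakos, §3.1). Junk value `0` where the lift is not differentiable. [folklore] -/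
def fderiv (f : UnitAddTorus d → F) (x : UnitAddTorus d) : EuclideanSpace ℝ d →L[ℝ] F :=
  _root_.fderiv ℝ (liftAt f x) 0

omit [DecidableEq d] in
/-- The directional derivative of `f : T^d → F` at `x` along `v ∈ ℝ^d`:
`d/dt|_{t=0} f (x + proj (t • v))` (Grafakos, §3.1). Definitionally equal (`rfl`) to the accepted
`Literature.Turb.torusLineDeriv u x v` at `WithLp.toLp 2 v` (Statements/Turb/Wave0, to be re-based on
this definition). Junk value `0` of `deriv` where not differentiable. [folklore] -/
def lineDeriv (f : UnitAddTorus d → F) (x : UnitAddTorus d) (v : EuclideanSpace ℝ d) : F :=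
  deriv (fun t : ℝ => f (x + proj (t • v))) 0

/-- The `i`-th partial derivative `∂ᵢ f (x)` of `f : T^d → F`, the directional derivative along
the standard basis vector `eᵢ = EuclideanSpace.single i 1` (Grafakos, §3.1). Definitionally equal
(`rfl`) to the accepted `Literature.Turb.torusPartialDeriv u i x` (Statements/Turb/Wave0). [folklore] -/
def partialDeriv (i : d) (f : UnitAddTorus d → F) (x : UnitAddTorus d) : F :=
  lineDeriv f x (EuclideanSpace.single i 1)

omit [DecidableEq d] in
/-- The gradient `∇θ (x) ∈ ℝ^d` of a scalar function `θ : T^d → ℝ`: Mathlib's `gradient` of the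
re-centred lift at `0` (Evans, App. A.3). [folklore] -/
def gradient (θ : UnitAddTorus d → ℝ) (x : UnitAddTorus d) : EuclideanSpace ℝ d :=
  _root_.gradient (liftAt θ x) 0

/-- The divergence `div u (x) = ∑ᵢ ∂ᵢ uᵢ (x)` of a vector field `u : T^d → ℝ^d`
(Fefferman, eq. (2); Evans, App. A.3). For `C¹` fields this is the trace of `Torus.fderiv u x`
(`divergence_eq_trace_fderiv`), matching the accepted `Literature.Analysis.FluidPDE.NSWave0.divergence`. [folklore] -/
def divergence (u : UnitAddTorus d → EuclideanSpace ℝ d) (x : UnitAddTorus d) : ℝ :=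
  ∑ i, partialDeriv i (fun y => u y i) x

omit [DecidableEq d] in
/-- The Laplacian `Δ f (x)` of `f : T^d → F`: Mathlib's `InnerProductSpace.laplacian` (`Δ`) of the
re-centred lift at `0` (Fefferman, eq. (1); Evans, App. A.3). [folklore] -/
def laplacian (f : UnitAddTorus d → F) (x : UnitAddTorus d) : F :=
  (Δ (liftAt f x)) 0

omit [DecidableEq d] in
/-- The convective derivative `((u·∇)v)(x) = Dv(x)[u(x)]` of a field `v : T^d → F` along a vector
field `u : T^d → ℝ^d` (Fefferman, eq. (1): `∑ⱼ uⱼ ∂ⱼ vᵢ`). [folklore] -/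
def convect (u : UnitAddTorus d → EuclideanSpace ℝ d) (v : UnitAddTorus d → F)
    (x : UnitAddTorus d) : F :=
  Torus.fderiv v x (u x)

/-- A vector field on `T^d` is divergence free if `div u = 0` everywhere (Fefferman, eq. (2)). [folklore] -/
def IsDivFree (u : UnitAddTorus d → EuclideanSpace ℝ d) : Prop :=
  ∀ x, divergence u x = 0

omit [DecidableEq d] in
/-- `f : T^d → F` has zero mean: `∫_{T^d} f = 0` (w.r.t. the probability measure `volume`)
(Grafakos, §3.1: `f̂(0) = 0`). Junk: also holds when `f` is not integrable (`∫ = 0`). [folklore] -/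
def HasZeroMean (f : UnitAddTorus d → F) : Prop :=
  ∫ x, f x = 0

/-! ### Basic identities -/

omit [Fintype d] [DecidableEq d] in
/-- The torus directional derivative is Mathlib's `lineDeriv` of the re-centred lift at `0`. [folklore] -/
theorem lineDeriv_eq_lineDeriv_liftAt (f : UnitAddTorus d → F) (x : UnitAddTorus d)
    (v : EuclideanSpace ℝ d) : lineDeriv f x v = _root_.lineDeriv ℝ (liftAt f x) 0 v := by
  simp [lineDeriv, _root_.lineDeriv, zero_add]

omit [DecidableEq d] in
/-- For `C¹` functions the directional derivative is the Fréchet derivative applied to the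
direction (Mathlib `DifferentiableAt.lineDeriv_eq_fderiv`). [folklore] -/
theorem lineDeriv_eq_fderiv_apply {f : UnitAddTorus d → F} (hf : IsContDiff 1 f)
    (x : UnitAddTorus d) (v : EuclideanSpace ℝ d) : lineDeriv f x v = Torus.fderiv f x v := by
  rw [lineDeriv_eq_lineDeriv_liftAt]
  exact ((hf.liftAt x).differentiable one_ne_zero).differentiableAt.lineDeriv_eq_fderiv

/-- For `C¹` functions, `∂ᵢ f (x) = Df(x)[eᵢ]`. [folklore] -/
theorem partialDeriv_eq_fderiv_apply {f : UnitAddTorus d → F} (hf : IsContDiff 1 f) (i : d)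
    (x : UnitAddTorus d) : partialDeriv i f x = Torus.fderiv f x (EuclideanSpace.single i 1) :=
  lineDeriv_eq_fderiv_apply hf x _

omit [DecidableEq d] in
/-- The Fréchet derivative of the global lift at `y` is the torus derivative at `proj y`
(the two lifts differ by the translation `v ↦ y + v`; Mathlib `fderiv_comp_add_left`, no
differentiability needed). [folklore] -/
theorem fderiv_lift (f : UnitAddTorus d → F) (y : EuclideanSpace ℝ d) :
    _root_.fderiv ℝ (lift f) y = Torus.fderiv f (proj y) := by
  rw [Torus.fderiv, liftAt_proj]
  change _ = _root_.fderiv ℝ (fun v => lift f (y + v)) 0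
  rw [fderiv_comp_add_left, add_zero]

/-- For `C¹` vector fields the divergence is the trace of the Fréchet derivative; this is the
bridge to the accepted `Literature.NS.divergence v x = trace (fderiv ℝ v x)` (Fefferman, eq. (2)). Proof:
`trace L = ∑ᵢ ⟪eᵢ, L eᵢ⟫ = ∑ᵢ (L eᵢ)ᵢ` (Mathlib `LinearMap.trace_eq_sum_inner` with the standard
orthonormal basis) and `∂ᵢ uᵢ (x) = (Du(x) eᵢ)ᵢ` (`partialDeriv_eq_fderiv_apply` for the component
`y ↦ u y i`, whose torus derivative is `projᵢ ∘ Du(x)` by the chain rule). [folklore] -/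
theorem divergence_eq_trace_fderiv {u : UnitAddTorus d → EuclideanSpace ℝ d} (hu : IsContDiff 1 u)
    (x : UnitAddTorus d) :
    divergence u x =
      LinearMap.trace ℝ (EuclideanSpace ℝ d)
        (Torus.fderiv u x : EuclideanSpace ℝ d →ₗ[ℝ] EuclideanSpace ℝ d) := by
  rw [LinearMap.trace_eq_sum_inner _ (EuclideanSpace.basisFun d ℝ), divergence]
  refine Finset.sum_congr rfl fun i _ => ?_
  have hui : IsContDiff 1 (fun y => u y i) :=
    (EuclideanSpace.proj i : EuclideanSpace ℝ d →L[ℝ] ℝ).contDiff.comp hu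
  have hd : DifferentiableAt ℝ (liftAt u x) 0 :=
    ((hu.liftAt x).differentiable one_ne_zero).differentiableAt
  have hcomp : Torus.fderiv (fun y => u y i) x =
      (EuclideanSpace.proj i : EuclideanSpace ℝ d →L[ℝ] ℝ).comp (Torus.fderiv u x) := by
    have h : liftAt (fun y => u y i) x =
        (EuclideanSpace.proj i : EuclideanSpace ℝ d →L[ℝ] ℝ) ∘ liftAt u x := by
      funext v; rfl
    rw [Torus.fderiv, Torus.fderiv, h]
    exact ((EuclideanSpace.proj i).hasFDerivAt.comp (0 : EuclideanSpace ℝ d) hd.hasFDerivAt).fderiv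
  rw [partialDeriv_eq_fderiv_apply hui, hcomp, EuclideanSpace.basisFun_apply,
    ContinuousLinearMap.coe_coe, EuclideanSpace.inner_single_left]
  simp

/-- For `C¹` vector fields, `Torus.IsDivFree u` iff the lift is divergence free in the sense of
the accepted `Literature.Analysis.FluidPDE.NSWave0.IsDivFree` (`trace (fderiv ℝ (lift u) y) = 0` for all `y ∈ ℝ^d`). [folklore] -/
theorem isDivFree_iff_trace_fderiv_lift
    {u : UnitAddTorus d → EuclideanSpace ℝ d} (hu : IsContDiff 1 u) :
    IsDivFree u ↔ ∀ y : EuclideanSpace ℝ d,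
      LinearMap.trace ℝ (EuclideanSpace ℝ d)
        (_root_.fderiv ℝ (lift u) y : EuclideanSpace ℝ d →ₗ[ℝ] EuclideanSpace ℝ d) = 0 := by
  constructor
  · intro h y
    rw [fderiv_lift, ← divergence_eq_trace_fderiv hu]
    exact h _
  · intro h x
    obtain ⟨y, rfl⟩ := proj_surjective x
    rw [divergence_eq_trace_fderiv hu, ← fderiv_lift]
    exact h y

omit [DecidableEq d] in
/-- The lift of a directional derivative of a `C¹` function is the corresponding directional
Fréchet derivative of the lift. [folklore] -/
theorem lift_lineDeriv {f : UnitAddTorus d → F} (hf : IsContDiff 1 f) (v : EuclideanSpace ℝ d) :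
    lift (fun x => lineDeriv f x v) = fun y => _root_.fderiv ℝ (lift f) y v := by
  funext y
  rw [lift_apply, lineDeriv_eq_fderiv_apply hf, fderiv_lift]

/-! ### Smoothness is preserved -/

omit [DecidableEq d] in
/-- Directional derivatives of smooth functions are smooth. [folklore] -/
theorem IsSmooth.lineDeriv {f : UnitAddTorus d → F} (hf : IsSmooth f) (v : EuclideanSpace ℝ d) :
    IsSmooth (fun x => lineDeriv f x v) := by
  unfold IsSmooth
  rw [lift_lineDeriv (hf.isContDiff (by simp)) v]
  exact (ContDiff.fderiv_right hf le_rfl).clm_apply contDiff_const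

/-- Partial derivatives of smooth functions are smooth. [folklore] -/
theorem IsSmooth.partialDeriv {f : UnitAddTorus d → F} (hf : IsSmooth f) (i : d) :
    IsSmooth (partialDeriv i f) :=
  hf.lineDeriv _

omit [DecidableEq d] in
/-- Fréchet derivatives of smooth functions, applied to a smooth vector field, are smooth; in
particular `convect u v` is smooth for smooth `u`, `v` (Mathlib `ContDiff.fderiv_right`,
`ContDiff.clm_apply`, via `fderiv_lift`). [folklore] -/
theorem IsSmooth.convect {u : UnitAddTorus d → EuclideanSpace ℝ d} {v : UnitAddTorus d → F}
    (hu : IsSmooth u) (hv : IsSmooth v) : IsSmooth (Torus.convect u v) := by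
  have h : lift (Torus.convect u v) = fun y => _root_.fderiv ℝ (lift v) y (lift u y) := by
    funext y
    rw [lift_apply, Torus.convect, ← fderiv_lift, lift_apply]
  unfold IsSmooth
  rw [h]
  exact (ContDiff.fderiv_right hv le_rfl).clm_apply hu

omit [DecidableEq d] in
/-- Coordinates of a smooth vector field are smooth. [folklore] -/
theorem IsSmooth.apply {u : UnitAddTorus d → EuclideanSpace ℝ d} (hu : IsSmooth u) (i : d) :
    IsSmooth (fun y => u y i) :=
  hu.comp_clm (EuclideanSpace.proj i)

/-- The divergence of a smooth vector field is smooth. [folklore] -/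
theorem IsSmooth.divergence {u : UnitAddTorus d → EuclideanSpace ℝ d} (hu : IsSmooth u) :
    IsSmooth (divergence u) :=
  ContDiff.sum fun i _ => (hu.apply i).partialDeriv i

omit [DecidableEq d] in
/-- Gradients of smooth scalar functions are smooth (the lift of `∇θ` is
`(toDual ℝ ℝ^d)⁻¹ ∘ D(lift θ)`; Mathlib `ContDiff.fderiv_right`). [folklore] -/
theorem IsSmooth.gradient {θ : UnitAddTorus d → ℝ} (hθ : IsSmooth θ) : IsSmooth (Torus.gradient θ) := by
  have h : lift (Torus.gradient θ) =
      fun y => (InnerProductSpace.toDual ℝ (EuclideanSpace ℝ d)).symm (_root_.fderiv ℝ (lift θ) y) := by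
    funext y
    rw [lift_apply, Torus.gradient, _root_.gradient, fderiv_lift]
    rfl
  unfold IsSmooth
  rw [h]
  exact (InnerProductSpace.toDual ℝ (EuclideanSpace ℝ d)).symm.contDiff.comp
    (ContDiff.fderiv_right hθ le_rfl)

omit [DecidableEq d] in
/-- Laplacians of smooth functions are smooth (the lift of `Δf` is
`y ↦ ∑ᵢ D²(lift f)(y)[eᵢ, eᵢ]`, Mathlib `laplacian_eq_iteratedFDeriv_stdOrthonormalBasis`,
`iteratedFDeriv_comp_add_left`, `ContDiff.iteratedFDeriv_right`). [folklore] -/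
theorem IsSmooth.laplacian {f : UnitAddTorus d → F} (hf : IsSmooth f) : IsSmooth (Torus.laplacian f) := by
  have h : lift (Torus.laplacian f) = fun y =>
      ∑ i, iteratedFDeriv ℝ 2 (lift f) y
        ![stdOrthonormalBasis ℝ (EuclideanSpace ℝ d) i, stdOrthonormalBasis ℝ (EuclideanSpace ℝ d) i] := by
    funext y
    rw [lift_apply, Torus.laplacian, liftAt_proj,
      InnerProductSpace.laplacian_eq_iteratedFDeriv_stdOrthonormalBasis]
    simp only [Function.comp_def, iteratedFDeriv_comp_add_left, add_zero]
  unfold IsSmooth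
  rw [h]
  exact ContDiff.sum fun i _ =>
    (ContinuousMultilinearMap.apply ℝ (fun _ : Fin 2 => EuclideanSpace ℝ d) F _).contDiff.comp
      (hf.iteratedFDeriv_right le_rfl)

/-! ### Integration by parts on the torus (no boundary terms) -/

/-- `∫_{T^d} ∂ᵢ f = 0` for smooth `f` (periodicity: fundamental theorem of calculus in the `i`-th
variable over one period; Grafakos, §3.1; Evans, App. C.2, Thm. 1 with empty boundary). [cite: Evans2010, App. C.2 Thm. 1] -/
def integral_partialDeriv_eq_zero : Prop :=
  ∀ {f : UnitAddTorus d → F} (hf : IsSmooth f) (i : d),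
    ∫ x, partialDeriv i f x = 0

/-- Divergence theorem on the torus: `∫_{T^d} div u = 0` for smooth `u`
(Evans, App. C.2, Thm. 1, no boundary). [cite: Evans2010, App. C.2 Thm. 1] -/
def integral_divergence_eq_zero : Prop :=
  ∀ {u : UnitAddTorus d → EuclideanSpace ℝ d} (hu : IsSmooth u),
    ∫ x, divergence u x = 0

/-- Integration by parts against a gradient: `∫ ⟪u, ∇θ⟫ = -∫ θ div u` for smooth `u`, `θ`
(Evans, App. C.2, Thm. 2, no boundary). [cite: Evans2010, App. C.2 Thm. 2] -/
def integral_inner_gradient_eq_neg_integral_mul_divergence : Prop :=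
  ∀ {u : UnitAddTorus d → EuclideanSpace ℝ d} {θ : UnitAddTorus d → ℝ} (hu : IsSmooth u) (hθ : IsSmooth θ),
    ∫ x, ⟪u x, gradient θ x⟫_ℝ = -∫ x, θ x * divergence u x

omit [DecidableEq d] in
/-- Green's second identity on the torus: `∫ θ Δφ = ∫ (Δθ) φ` for smooth scalar `θ`, `φ`
(Evans, App. C.2, Thm. 3 (iii), no boundary). [cite: Evans2010, App. C.2 Thm. 3 (iii)] -/
def integral_mul_laplacian_comm : Prop :=
  ∀ {θ φ : UnitAddTorus d → ℝ} (hθ : IsSmooth θ) (hφ : IsSmooth φ),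
    ∫ x, θ x * laplacian φ x = ∫ x, laplacian θ x * φ x

/-- Energy identity `∫ ⟪u, Δu⟫ = -∑ᵢ ∫ ‖∂ᵢ u‖²` for smooth fields with values in a real inner
product space (Evans, App. C.2, Thm. 3 (i)/(ii), no boundary; the enstrophy identity behind
`Turb.gradNormSq`). [cite: Evans2010, App. C.2 Thm. 3 (i)] -/
def integral_inner_laplacian_eq_neg : Prop :=
  ∀ {G : Type*} [NormedAddCommGroup G] [InnerProductSpace ℝ G] {u : UnitAddTorus d → G} (hu : IsSmooth u),
    ∫ x, ⟪u x, laplacian u x⟫_ℝ = -∑ i, ∫ x, ‖partialDeriv i u x‖ ^ 2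

end Space

/-! ## Space–time smoothness -/

section SpaceTime

omit [DecidableEq d]

/-- Joint smoothness of `u : ℝ → T^d → F` on the time set `S` (e.g. `Icc 0 T`, `Ici 0`):
the space–time lift is `C^∞` on `S ×ˢ univ` (Fefferman, (A)/(B): `u ∈ C^∞(T^d × [0,∞))`;
cf. `Literature.Analysis.FluidPDE.IsSmoothOnHalfSpace`, the case `S = Ici 0` after lifting). [folklore] -/
def IsSmoothSpaceTimeOn (S : Set ℝ) (u : ℝ → UnitAddTorus d → F) : Prop :=
  ContDiffOn ℝ ∞ (stLift u) (S ×ˢ Set.univ)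

/-- A jointly smooth space–time field has smooth time slices `u t` for `t ∈ S` (compose the
space–time lift with `y ↦ (t, y)`; Mathlib `ContDiffOn.comp_contDiff`). [folklore] -/
theorem IsSmoothSpaceTimeOn.isSmooth_slice {S : Set ℝ} {u : ℝ → UnitAddTorus d → F}
    (hu : IsSmoothSpaceTimeOn S u) {t : ℝ} (ht : t ∈ S) : IsSmooth (u t) := by
  change ContDiff ℝ ∞ (stLift u ∘ fun y : EuclideanSpace ℝ d => (t, y))
  exact hu.comp_contDiff (contDiff_prodMk_right t) fun y => Set.mk_mem_prod ht (Set.mem_univ y)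

end SpaceTime

end Torus

end

end Literature.Analysis.FunctionSpaces
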